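import Summits.QuantumFields.YangMills.Theorems.FluctuationComparisonRegPrIntLS2BetaLaplaceInstShift
import Summits.QuantumFields.YangMills.Theorems.FluctuationComparisonRegPrIntLS2BetaBoundPeano
import Summits.QuantumFields.YangMills.Theorems.FluctuationComparisonRegPrIntLS2BetaHessianDetRows
import Summits.QuantumFields.YangMills.Theorems.FluctuationComparisonRegPrIntLS2BetaArgminGlue
import HarnessLib

/-!
# S2β · LAPLACE row — DET-REP-A, ONE EDGE: (REP)+(DET) FOR THE OPERATORS OF RECORD ALONG A PATH OF WINDOW DATA, COMMON-TUBE ROUTE (pen w5-20520 g14)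

Cell `ym3-torus` (rung R3: continuum `SU(2)` Yang–Mills on `T³` — NOT `d = 4`, NOT infinite volume, NOT a mass gap, NOT Clay); width seat `ym-ust-20520-w5` g14;
helper of the crux `stmt-QuantumFields-20520` (`--supports`, NOT a proof of it).  THEOREMS ONLY (0 `def`, 0 `sorry`; default heartbeats); hypothesis form.

WHY (FOUR-POINT-DECAY `stub_fourPtDecay` of LINE g18-1 `Lines/semiclassical_s2beta.lean` v10.1; LINE-OWNER RULING (W3)(2): v11 = DET-REP-A «(REP)+(DET) for the
operators OF RECORD» ⊕ DET-REP-B «(LOC)+(JAC) for THOSE operators», common-tube route; px19 g10's degenerate witness `ι := Unit, M := 1` must be excluded by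
BINDING `M` to the background).  THIS FILE is the kernel integration of the kit for ONE EDGE `s ↦ x s` (`s ∈ I` open) of a window quadrilateral: in the common
tube ⟨`e, σ, UZ, UV, jZ, jV, ρ`⟩ of one corner, along a path of transversal coordinates `y s ∈ UV` of the minimiser orbits, with `f (s, y) := A(c.Φ(x s, σ y))`,
`H s :=` the slice Hessian of `f` at `(s, y s)` and `M s := (H s (b i) (b j))ᵢⱼ` in the standard orthonormal basis `b` of `ℝ^{dV}`:
* (REP) `λ^{dV/2}·(heightDensityCan (γ/λ) (x s)·e^{λ β_K m(x s)}) → exp (c₀ + (log jV(y s) + log jac(x s, σ(y s))) − ½·log det (M s))` with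
  `c₀ = log((2π)^{dV/2}·ν(univ)·∫_{ball ρ} jZ ∕ (ν((e''ball ρ)·Sst)⁻¹·β_K^{dV/2}))` EDGE-INDEPENDENT;
* (DET) the entries of `M` are `C¹` on `I` (`HasDerivAt` with `deriv`, continuous), `M s` is positive definite, `0 < det (M s)`; `y` is `C²` on `I`.
So `det` in the Laplace exponent IS `det M` of the (DET) rows: with `M := 1` the (REP) row would force `det H = 1` — the rows bind.

PROOF = ✓`…BoundPeano.boundPeano_rows` (operator `continuousLinearMapOfBilin (D²φ_s 0)`, `φ_s v := f (s, y s + v)`) → ✓(CT) `…LaplaceInstShift.laplaceLimit_of_charts_tendsto_shift`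
at `y₁ := y s` → ✓`det_clmOfBilin_eq_det_matrix` + ✓`fderiv_fderiv_slice_eq` → ✓`…ArgminGlue.cornerConst_eq_exp`; (DET) = ✓`…HessianDetRows.sliceHessian_detRows`
(`hcrit` from the transversal growth: a local minimum).  DISPLAYED (v11 docks them): the CHART∞ rows at every `x s`, the product tube (px21 ✓E3∕E3″), the path rows —
`y s ∈ UV`, (F3) at `(0, y s)`, local carrier, stabiliser, EXW (charted into `Sf`, action `m (x s)`), GAP♯ strict off the orbit of `σ (y s)`, transversal growth
(GAP♯ ∘ (T2)), `ContinuousAt y s` (✓`tendsto_of_isMinOn_of_growth`), `ContDiffAt ℝ 3 f (s, y s)` (✓(C2′)), positivity of `jV (y s)`, `jac`, `ν((e''ball ρ)·Sst)⁻¹`.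

HONEST SCOPE.  Assembly of landed letters; DET-REP-B ((LOC)+(JAC)) is the organ and is NOT here; proves no stub; EXW ∕ GAP♯ ∕ FOUR-POINT-DECAY ∕ H4ᶜ ∕ LFR♯ᶜ ∕ LAPLACE ∕
S2β ∕ the crux 20520 NOT proved; `YM3TorusSU2` NOT proved; the Yang–Mills mass gap (Clay) NOT proved.

References: [Breitung1994] Thm 41 p. 56; [Balaban1985Variational] CMP 102 (1985) Thm 1 (8)–(10) p. 279, (142) p. 299; [Helgason2000] Ch. I §1 Thm 1.14 p. 96;
[Dieudonne1960] Ch. X §2 (10.2.1)–(10.2.3).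
-/

noncomputable section

open MeasureTheory MeasureTheory.Measure Filter Topology Set Module Metric Function
open scoped Real InnerProductSpace ENNReal NNReal Pointwise Matrix
open Literature.MathematicalPhysics.QuantumFieldTheory.Balaban1983to89
open Literature.MathematicalPhysics.QuantumFieldTheory.Balaban1983to89.T3ContinuumYM3Torus
open Literature.MathematicalPhysics.QuantumFieldTheory.Balaban1983to89.T3UnitLawDensityEML
open scoped Literature.MathematicalPhysics.QuantumFieldTheory.Balaban1983to89.T3OrbitAverage
open Summit.QuantumFields.YangMills.Theorems.FluctuationComparisonRegPrIntLWregGlue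
open Summit.QuantumFields.YangMills.Theorems.FluctuationComparisonRegPrIntLS2BetaLaplaceInstShift
open Summit.QuantumFields.YangMills.Theorems.FluctuationComparisonRegPrIntLS2BetaBoundPeano
open Summit.QuantumFields.YangMills.Theorems.FluctuationComparisonRegPrIntLS2BetaHessianDetRows
open Summit.QuantumFields.YangMills.Theorems.FluctuationComparisonRegPrIntLS2BetaArgminGlue
open Summit.QuantumFields.YangMills.Theorems.FluctuationComparisonRegPrIntLS2BetaCriticalFamily (contDiffAt_partialFDeriv)

namespace Summit.QuantumFields.YangMills.Theorems.FluctuationComparisonRegPrIntLS2BetaDetRepAEdge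

/-- ★★★ **DET-REP-A, ONE EDGE (common tube; hypothesis form).**  See the module docstring: (REP) the corner-limit of every path datum `x s` in EXPONENTIAL FORM with the
EDGE-INDEPENDENT constant `c₀` and the determinant of the BOUND matrix `M s = (H s (b i) (b j))ᵢⱼ` of the slice Hessian of `f (s,y) := A(c.Φ(x s, σ y))` at `(s, y s)`;
(DET) the `C¹` ∕ positive-definite ∕ `0 < det` rows of `M` on `I`, and `y ∈ C²(I)`.
[cite: Breitung1994, Thm 41 p.56] [cite: Balaban1985Variational, Thm 1 (8)-(10) p.279, (142) p.299] [cite: Helgason2000, Ch. I §1 Thm 1.14 p.96] [cite: Dieudonne1960, Ch. X §2 (10.2.1)] -/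
theorem detRepA_edge
    (F : T3Family) {γ : ℝ} (hγ : 0 < γ) {J K : ℕ} (hJK : J ≤ K)
    {Sf : Set (GaugeField (F.P K) 0 (Matrix.specialUnitaryGroup (Fin 2) ℂ))} (hSf : MeasurableSet Sf)
    {O : Set (GaugeField (F.P J) 0 (Matrix.specialUnitaryGroup (Fin 2) ℂ))} (hO : IsOpen O)
    (c : WindowChart F hJK Sf O) (m : GaugeField (F.P J) 0 (Matrix.specialUnitaryGroup (Fin 2) ℂ) → ℝ)
    (S : Subgroup (Site (F.P K) 0 → Matrix.specialUnitaryGroup (Fin 2) ℂ)) (hS : CompactSpace S)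
    (ν : Measure (S × (PBond (F.P K) (K - J) → Matrix.specialUnitaryGroup (Fin 2) ℂ))) [ν.IsHaarMeasure]
    (act : S × (PBond (F.P K) (K - J) → Matrix.specialUnitaryGroup (Fin 2) ℂ) →
      GaugeField (F.P K) 0 (Matrix.specialUnitaryGroup (Fin 2) ℂ) → GaugeField (F.P K) 0 (Matrix.specialUnitaryGroup (Fin 2) ℂ))
    (hact : Continuous fun p : (S × (PBond (F.P K) (K - J) → Matrix.specialUnitaryGroup (Fin 2) ℂ)) ×
      GaugeField (F.P K) 0 (Matrix.specialUnitaryGroup (Fin 2) ℂ) => act p.1 p.2)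
    (hmul : ∀ k k' z, act (k * k') z = act k (act k' z)) (hone : ∀ z, act 1 z = z)
    (hpres : ∀ k, MeasurePreserving (act k) (fieldMeasure (F.P K) 0 (Matrix.specialUnitaryGroup (Fin 2) ℂ))
      (fieldMeasure (F.P K) 0 (Matrix.specialUnitaryGroup (Fin 2) ℂ)))
    -- the path of window data and the CHART∞ rows at every path datum
    {I : Set ℝ} (hI : IsOpen I) (x : ℝ → GaugeField (F.P J) 0 (Matrix.specialUnitaryGroup (Fin 2) ℂ)) (hx : ∀ s ∈ I, x s ∈ O)
    (Xc : ℝ → Set (GaugeField (F.P K) 0 (Matrix.specialUnitaryGroup (Fin 2) ℂ))) (hXc : ∀ s ∈ I, IsCompact (Xc s))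
    (hXinv : ∀ s ∈ I, ∀ k z, z ∈ Xc s → act k z ∈ Xc s)
    (hvan : ∀ s ∈ I, ∀ z, z ∉ Xc s → (c.jac (x s, z) : ℝ) = 0)
    (hA : ∀ s ∈ I, ContinuousOn (fun z => wilsonAction4 (c.Φ (x s, z))) (Xc s)) (ha : ∀ s ∈ I, ContinuousOn (fun z => (c.jac (x s, z) : ℝ)) (Xc s))
    (hAinv : ∀ s ∈ I, ∀ k, ∀ z ∈ Xc s, wilsonAction4 (c.Φ (x s, act k z)) = wilsonAction4 (c.Φ (x s, z)))
    (hainv : ∀ s ∈ I, ∀ k, ∀ z ∈ Xc s, (c.jac (x s, act k z) : ℝ) = c.jac (x s, z))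
    (hOrel : ∀ s ∈ I, IsOpen ((Subtype.val : Xc s → GaugeField (F.P K) 0 (Matrix.specialUnitaryGroup (Fin 2) ℂ)) ⁻¹' {z | c.Φ (x s, z) ∈ Sf}))
    (hOinv : ∀ s ∈ I, ∀ k, ∀ z ∈ Xc s, c.Φ (x s, z) ∈ Sf → c.Φ (x s, act k z) ∈ Sf)
    -- ONE product tube (px21 (F1)(F2) rows) at the corner minimiser
    {dZ dV : ℕ} (e : EuclideanSpace ℝ (Fin dZ) → S × (PBond (F.P K) (K - J) → Matrix.specialUnitaryGroup (Fin 2) ℂ))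
    (σ : EuclideanSpace ℝ (Fin dV) → GaugeField (F.P K) 0 (Matrix.specialUnitaryGroup (Fin 2) ℂ))
    (he : Continuous e) (he1 : e 0 = 1) (he𝓝 : 𝓝 (1 : S × (PBond (F.P K) (K - J) → Matrix.specialUnitaryGroup (Fin 2) ℂ)) ≤ map e (𝓝 0))
    (hσ : Continuous σ)
    {UZ : Set (EuclideanSpace ℝ (Fin dZ))} {UV : Set (EuclideanSpace ℝ (Fin dV))} (hUZo : IsOpen UZ) (hUVo : IsOpen UV)
    (hinj : InjOn (fun p : EuclideanSpace ℝ (Fin dZ) × EuclideanSpace ℝ (Fin dV) => act (e p.1) (σ p.2)) (UZ ×ˢ UV))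
    {jZ : EuclideanSpace ℝ (Fin dZ) → ℝ} {jV : EuclideanSpace ℝ (Fin dV) → ℝ} (hjZc : ContinuousOn jZ UZ) (hjVc : ContinuousOn jV UV)
    (hjZ0 : ∀ z ∈ UZ, 0 ≤ jZ z) (hjV0 : ∀ y ∈ UV, 0 ≤ jV y)
    (hchart : (fieldMeasure (F.P K) 0 (Matrix.specialUnitaryGroup (Fin 2) ℂ)).restrict
        ((fun p : EuclideanSpace ℝ (Fin dZ) × EuclideanSpace ℝ (Fin dV) => act (e p.1) (σ p.2)) '' (UZ ×ˢ UV)) =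
      ((((volume : Measure (EuclideanSpace ℝ (Fin dZ))).prod (volume : Measure (EuclideanSpace ℝ (Fin dV)))).restrict (UZ ×ˢ UV)).withDensity
          fun w => ENNReal.ofReal (jZ w.1 * jV w.2)).map (fun p : EuclideanSpace ℝ (Fin dZ) × EuclideanSpace ℝ (Fin dV) => act (e p.1) (σ p.2)))
    {ρ : ℝ} (hρ : 0 < ρ) (hρUZ : closedBall (0 : EuclideanSpace ℝ (Fin dZ)) ρ ⊆ UZ) (hjZint : 0 < ∫ z in ball (0 : EuclideanSpace ℝ (Fin dZ)) ρ, jZ z)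
    {Sst : Set (S × (PBond (F.P K) (K - J) → Matrix.specialUnitaryGroup (Fin 2) ℂ))} (hfix : ∀ s' ∈ Sst, ∀ y, act s' (σ y) = σ y)
    (hνS : 0 < (ν (((e '' ball (0 : EuclideanSpace ℝ (Fin dZ)) ρ) * Sst)⁻¹)).toReal)
    -- the PATH rows in the common tube
    (y : ℝ → EuclideanSpace ℝ (Fin dV)) (hyUV : ∀ s ∈ I, y s ∈ UV) (hjVy : ∀ s ∈ I, 0 < jV (y s))
    (hopen : ∀ s ∈ I, 𝓝 (σ (y s)) ≤ map (fun p : EuclideanSpace ℝ (Fin dZ) × EuclideanSpace ℝ (Fin dV) => act (e p.1) (σ p.2)) (𝓝 (0, y s)))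
    (hσX : ∀ s ∈ I, ∀ᶠ v in 𝓝 (y s), σ v ∈ Xc s)
    (hstab : ∀ s ∈ I, ∀ k, act k (σ (y s)) = σ (y s) → k ∈ Sst)
    (hO0 : ∀ s ∈ I, c.Φ (x s, σ (y s)) ∈ Sf) (hmin : ∀ s ∈ I, wilsonAction4 (c.Φ (x s, σ (y s))) = m (x s))
    (hjacpos : ∀ s ∈ I, 0 < (c.jac (x s, σ (y s)) : ℝ))
    (g : ℝ → GaugeField (F.P K) 0 (Matrix.specialUnitaryGroup (Fin 2) ℂ) → ℝ) (hg : ∀ s ∈ I, ContinuousOn (g s) (Xc s))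
    (hg0 : ∀ s ∈ I, ∀ z ∈ Xc s, 0 ≤ g s z) (hgpos : ∀ s ∈ I, ∀ z ∈ Xc s, (∀ k, act k (σ (y s)) ≠ z) → 0 < g s z)
    (hgrow : ∀ s ∈ I, ∀ z ∈ Xc s, c.Φ (x s, z) ∈ Sf → m (x s) + g s z ≤ wilsonAction4 (c.Φ (x s, z)))
    {c₁ : ℝ} (hc₁ : 0 < c₁)
    (hgrowT : ∀ s ∈ I, ∀ᶠ v in 𝓝 (0 : EuclideanSpace ℝ (Fin dV)),
      c₁ * ‖v‖ ^ 2 ≤ wilsonAction4 (c.Φ (x s, σ (y s + v))) - wilsonAction4 (c.Φ (x s, σ (y s))))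
    (hyc : ∀ s ∈ I, ContinuousAt y s)
    (hf3 : ∀ s ∈ I, ContDiffAt ℝ 3 (fun q : ℝ × EuclideanSpace ℝ (Fin dV) => wilsonAction4 (c.Φ (x q.1, σ q.2))) (s, y s)) :
    -- (REP): the corner limits in exponential form, with the BOUND matrix
    (∀ s ∈ I, Tendsto (fun lam : ℝ => lam ^ ((dV : ℝ) / 2) *
        (heightDensityCan F (γ / lam) hJK Sf (x s) * Real.exp (lam * (F.scheme ℰp γ).β K * m (x s)))) atTop
      (𝓝 (Real.exp (Real.log ((2 * π) ^ ((dV : ℝ) / 2) * ν.real univ * (∫ z in ball (0 : EuclideanSpace ℝ (Fin dZ)) ρ, jZ z) /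
          ((ν (((e '' ball (0 : EuclideanSpace ℝ (Fin dZ)) ρ) * Sst)⁻¹)).toReal * ((F.scheme ℰp γ).β K) ^ ((dV : ℝ) / 2))) +
        (Real.log (jV (y s)) + Real.log (c.jac (x s, σ (y s)) : ℝ)) -
        (1 / 2) * Real.log (Matrix.of fun i j =>
          ((fderiv ℝ (fun q : ℝ × EuclideanSpace ℝ (Fin dV) =>
              (fderiv ℝ (fun q : ℝ × EuclideanSpace ℝ (Fin dV) => wilsonAction4 (c.Φ (x q.1, σ q.2))) q).comp
                (ContinuousLinearMap.inr ℝ ℝ (EuclideanSpace ℝ (Fin dV)))) (s, y s)).comp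
            (ContinuousLinearMap.inr ℝ ℝ (EuclideanSpace ℝ (Fin dV))))
            ((EuclideanSpace.basisFun (Fin dV) ℝ) i) ((EuclideanSpace.basisFun (Fin dV) ℝ) j)).det)))) ∧
    -- (DET): the rows of the bound matrix along the edge
    (∀ s ∈ I, ContDiffAt ℝ 2 y s) ∧
    (∀ s ∈ I, ∀ i j, HasDerivAt (fun s => ((fderiv ℝ (fun q : ℝ × EuclideanSpace ℝ (Fin dV) =>
              (fderiv ℝ (fun q : ℝ × EuclideanSpace ℝ (Fin dV) => wilsonAction4 (c.Φ (x q.1, σ q.2))) q).comp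
                (ContinuousLinearMap.inr ℝ ℝ (EuclideanSpace ℝ (Fin dV)))) (s, y s)).comp
            (ContinuousLinearMap.inr ℝ ℝ (EuclideanSpace ℝ (Fin dV))))
            ((EuclideanSpace.basisFun (Fin dV) ℝ) i) ((EuclideanSpace.basisFun (Fin dV) ℝ) j))
      (deriv (fun s => ((fderiv ℝ (fun q : ℝ × EuclideanSpace ℝ (Fin dV) =>
              (fderiv ℝ (fun q : ℝ × EuclideanSpace ℝ (Fin dV) => wilsonAction4 (c.Φ (x q.1, σ q.2))) q).comp
                (ContinuousLinearMap.inr ℝ ℝ (EuclideanSpace ℝ (Fin dV)))) (s, y s)).comp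
            (ContinuousLinearMap.inr ℝ ℝ (EuclideanSpace ℝ (Fin dV))))
            ((EuclideanSpace.basisFun (Fin dV) ℝ) i) ((EuclideanSpace.basisFun (Fin dV) ℝ) j)) s) s) ∧
    (∀ i j, ContinuousOn (deriv (fun s => ((fderiv ℝ (fun q : ℝ × EuclideanSpace ℝ (Fin dV) =>
              (fderiv ℝ (fun q : ℝ × EuclideanSpace ℝ (Fin dV) => wilsonAction4 (c.Φ (x q.1, σ q.2))) q).comp
                (ContinuousLinearMap.inr ℝ ℝ (EuclideanSpace ℝ (Fin dV)))) (s, y s)).comp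
            (ContinuousLinearMap.inr ℝ ℝ (EuclideanSpace ℝ (Fin dV))))
            ((EuclideanSpace.basisFun (Fin dV) ℝ) i) ((EuclideanSpace.basisFun (Fin dV) ℝ) j))) I) ∧
    (∀ s ∈ I, (Matrix.of fun i j => ((fderiv ℝ (fun q : ℝ × EuclideanSpace ℝ (Fin dV) =>
              (fderiv ℝ (fun q : ℝ × EuclideanSpace ℝ (Fin dV) => wilsonAction4 (c.Φ (x q.1, σ q.2))) q).comp
                (ContinuousLinearMap.inr ℝ ℝ (EuclideanSpace ℝ (Fin dV)))) (s, y s)).comp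
            (ContinuousLinearMap.inr ℝ ℝ (EuclideanSpace ℝ (Fin dV))))
            ((EuclideanSpace.basisFun (Fin dV) ℝ) i) ((EuclideanSpace.basisFun (Fin dV) ℝ) j)).PosDef) ∧
    (∀ s ∈ I, 0 < (Matrix.of fun i j => ((fderiv ℝ (fun q : ℝ × EuclideanSpace ℝ (Fin dV) =>
              (fderiv ℝ (fun q : ℝ × EuclideanSpace ℝ (Fin dV) => wilsonAction4 (c.Φ (x q.1, σ q.2))) q).comp
                (ContinuousLinearMap.inr ℝ ℝ (EuclideanSpace ℝ (Fin dV)))) (s, y s)).comp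
            (ContinuousLinearMap.inr ℝ ℝ (EuclideanSpace ℝ (Fin dV))))
            ((EuclideanSpace.basisFun (Fin dV) ℝ) i) ((EuclideanSpace.basisFun (Fin dV) ℝ) j)).det) := by
  classical
  haveI : CompactSpace S := hS
  -- abbreviations
  set f : ℝ × EuclideanSpace ℝ (Fin dV) → ℝ := fun q => wilsonAction4 (c.Φ (x q.1, σ q.2)) with hf
  set b : OrthonormalBasis (Fin dV) ℝ (EuclideanSpace ℝ (Fin dV)) := EuclideanSpace.basisFun (Fin dV) ℝ with hb
  set Hs : ℝ → EuclideanSpace ℝ (Fin dV) →L[ℝ] (EuclideanSpace ℝ (Fin dV) →L[ℝ] ℝ) := fun s =>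
    ((fderiv ℝ (fun q : ℝ × EuclideanSpace ℝ (Fin dV) => (fderiv ℝ f q).comp (ContinuousLinearMap.inr ℝ ℝ (EuclideanSpace ℝ (Fin dV)))) (s, y s)).comp
      (ContinuousLinearMap.inr ℝ ℝ (EuclideanSpace ℝ (Fin dV)))) with hHs
  -- the slice `φ_s` and its rows
  have hφ2 : ∀ s ∈ I, ContDiffAt ℝ 2 (fun v : EuclideanSpace ℝ (Fin dV) => f (s, y s + v)) 0 := by
    intro s hs
    have hf2 : ContDiffAt ℝ 2 f (s, y s + 0) := by rw [add_zero]; exact (hf3 s hs).of_le (by norm_num)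
    exact ContDiffAt.comp (g := f) (f := fun v : EuclideanSpace ℝ (Fin dV) => ((s : ℝ), y s + v)) 0 hf2
      (contDiffAt_const.prodMk (contDiffAt_const.add contDiffAt_id))
  have hφgrow : ∀ s ∈ I, ∀ᶠ v in 𝓝 (0 : EuclideanSpace ℝ (Fin dV)),
      c₁ * ‖v‖ ^ 2 ≤ (fun v : EuclideanSpace ℝ (Fin dV) => f (s, y s + v)) v - (fun v : EuclideanSpace ℝ (Fin dV) => f (s, y s + v)) 0 := by
    intro s hs
    filter_upwards [hgrowT s hs] with v hv
    simpa only [hf, add_zero] using hv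
  -- the slice Hessian is positive at every path point (boundPeano rows 1 + 3, and the slice identity)
  have hHpos : ∀ s ∈ I, ∀ v : EuclideanSpace ℝ (Fin dV), v ≠ 0 → 0 < Hs s v v := by
    intro s hs v hv
    obtain ⟨hAB, -, hposA, -⟩ := boundPeano_rows (hφ2 s hs) hc₁ (hφgrow s hs)
    have h1 := hposA v hv
    rw [hAB, fderiv_fderiv_slice_eq ((hf3 s hs).of_le (by norm_num)) v v] at h1
    exact h1
  -- criticality from the growth (a local minimum of the slice)
  have hcrit : ∀ s ∈ I, fderiv ℝ (fun v : EuclideanSpace ℝ (Fin dV) => f (s, v)) (y s) = 0 := by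
    intro s hs
    have hmin' : IsLocalMin (fun v : EuclideanSpace ℝ (Fin dV) => f (s, y s + v)) 0 := by
      filter_upwards [hφgrow s hs] with v hv
      nlinarith [sq_nonneg ‖v‖, hc₁.le]
    have h0 : fderiv ℝ (fun v : EuclideanSpace ℝ (Fin dV) => f (s, y s + v)) 0 = 0 := hmin'.fderiv_eq_zero
    have h1 : fderiv ℝ (fun v : EuclideanSpace ℝ (Fin dV) => f (s, y s + v)) 0 = fderiv ℝ (fun v : EuclideanSpace ℝ (Fin dV) => f (s, v)) (y s + 0) :=
      fderiv_comp_add_left (f := fun v : EuclideanSpace ℝ (Fin dV) => f (s, v)) (y s)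
    rw [h1, add_zero] at h0
    exact h0
  -- (DET) rows
  obtain ⟨hyC2, -, hDer, hDerC, hPD, hdet⟩ :=
    sliceHessian_detRows b.toBasis hI hf3 hcrit hyc hHpos
  have hbco : ∀ i, b.toBasis i = b i := fun i => by rw [OrthonormalBasis.coe_toBasis]
  -- β_K > 0 and the constant's positivity
  have hβ : 0 < (F.scheme ℰp γ).β K := by
    show 0 < (γ * (F.P K).eps)⁻¹
    exact inv_pos.2 (mul_pos hγ (F.P K).eps_pos)
  have hνu : 0 < ν.real univ := by
    rw [Measure.real, ENNReal.toReal_pos_iff]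
    exact ⟨pos_iff_ne_zero.2 (IsOpenPosMeasure.open_pos _ isOpen_univ univ_nonempty), measure_lt_top ν _⟩
  refine ⟨?_, hyC2, ?_, ?_, ?_, ?_⟩
  · -- (REP)
    intro s hs
    obtain ⟨hAB, hAs, hposA, hS2⟩ := boundPeano_rows (hφ2 s hs) hc₁ (hφgrow s hs)
    set Ah : EuclideanSpace ℝ (Fin dV) →L[ℝ] EuclideanSpace ℝ (Fin dV) :=
      InnerProductSpace.continuousLinearMapOfBilin (𝕜 := ℝ) (fderiv ℝ (fderiv ℝ (fun v : EuclideanSpace ℝ (Fin dV) => f (s, y s + v))) 0) with hAh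
    have hS2' : (fun v => wilsonAction4 (c.Φ (x s, σ (y s + v))) - wilsonAction4 (c.Φ (x s, σ (y s))) -
        (1 / 2) * ⟪(Ah : EuclideanSpace ℝ (Fin dV) →ₗ[ℝ] EuclideanSpace ℝ (Fin dV)) v, v⟫_ℝ) =o[𝓝 0] fun v => ‖v‖ ^ 2 := by
      refine hS2.congr' (Eventually.of_forall fun v => ?_) (Eventually.of_forall fun v => rfl)
      simp only [hf, add_zero, ContinuousLinearMap.coe_coe]
    have hposA' : ∀ v, v ≠ 0 → 0 < ⟪(Ah : EuclideanSpace ℝ (Fin dV) →ₗ[ℝ] EuclideanSpace ℝ (Fin dV)) v, v⟫_ℝ := fun v hv => by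
      rw [ContinuousLinearMap.coe_coe]; exact hposA v hv
    have hlim := laplaceLimit_of_charts_tendsto_shift F hγ hJK hSf hO c (hx s hs) (m (x s)) S hS ν act hact hmul hone hpres
      (hXc s hs) (hXinv s hs) (hvan s hs) (hA s hs) (ha s hs) (hAinv s hs) (hainv s hs) (hOrel s hs) (hOinv s hs)
      e σ he he1 he𝓝 hσ hUZo hUVo hinj hjZc hjVc hjZ0 hjV0 hchart hρ hρUZ (hyUV s hs) (hopen s hs) (hσX s hs) (hstab s hs) hfix
      (hO0 s hs) (hmin s hs) (hg s hs) (hg0 s hs) (hgpos s hs) (hgrow s hs) hAs hposA' hS2'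
    -- the determinant of the bound operator is the determinant of the slice-Hessian matrix
    have hdetEq : LinearMap.det (Ah : EuclideanSpace ℝ (Fin dV) →ₗ[ℝ] EuclideanSpace ℝ (Fin dV)) =
        (Matrix.of fun i j => Hs s (b i) (b j)).det := by
      rw [hAh, det_clmOfBilin_eq_det_matrix b]
      congr 1
      ext i j
      simp only [Matrix.of_apply]
      exact fderiv_fderiv_slice_eq ((hf3 s hs).of_le (by norm_num)) (b i) (b j)
    have hdetpos : 0 < (Matrix.of fun i j => Hs s (b i) (b j)).det := by
      have := hdet s hs
      simpa only [hbco] using this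
    have hApos : 0 < (2 * π) ^ ((dV : ℝ) / 2) := by positivity
    have hPpos : 0 < ((F.scheme ℰp γ).β K) ^ ((dV : ℝ) / 2) := Real.rpow_pos_of_pos hβ _
    have hform : (2 * π) ^ ((dV : ℝ) / 2) * (ν.real univ *
        ((∫ z in ball (0 : EuclideanSpace ℝ (Fin dZ)) ρ, jZ z) * jV (y s) / (ν (((e '' ball (0 : EuclideanSpace ℝ (Fin dZ)) ρ) * Sst)⁻¹)).toReal *
          (c.jac (x s, σ (y s)) : ℝ) / Real.sqrt (Matrix.of fun i j => Hs s (b i) (b j)).det)) / ((F.scheme ℰp γ).β K) ^ ((dV : ℝ) / 2) =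
        Real.exp (Real.log ((2 * π) ^ ((dV : ℝ) / 2) * ν.real univ * (∫ z in ball (0 : EuclideanSpace ℝ (Fin dZ)) ρ, jZ z) /
          ((ν (((e '' ball (0 : EuclideanSpace ℝ (Fin dZ)) ρ) * Sst)⁻¹)).toReal * ((F.scheme ℰp γ).β K) ^ ((dV : ℝ) / 2))) +
        (Real.log (jV (y s)) + Real.log (c.jac (x s, σ (y s)) : ℝ)) - (1 / 2) * Real.log (Matrix.of fun i j => Hs s (b i) (b j)).det) := by
      rw [← cornerConst_eq_exp hApos hνu hjZint (hjVy s hs) hνS (hjacpos s hs) hdetpos hPpos]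
      ring
    rw [hdetEq, hform] at hlim
    exact hlim
  · intro s hs i j; simpa only [hbco] using hDer s hs i j
  · intro i j; simpa only [hbco] using hDerC i j
  · intro s hs; simpa only [hbco] using hPD s hs
  · intro s hs; simpa only [hbco] using hdet s hs

end Summit.QuantumFields.YangMills.Theorems.FluctuationComparisonRegPrIntLS2BetaDetRepAEdge

end
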